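/-
Chen 2024 (IACR ePrint 2024/555, version of 2024-04-18), §3.5.6 pp. 27–29 and §3.6.4 pp. 52–56: Lemma 3.27 /
Lemma 3.28 — the SUPPORT of `|φ₆⟩` along the line `x` (the `2Dj·x` comb of eq. (29) = (75)) — EXACTLY, for the
untruncated states, starting from the kernel-checked dual form `phi6_karst` (`ChenQuantumLWEStepSix`).

REPRODUCTION / ANALYSIS OF A CLAIMED RESULT UNDER ADJUDICATION (withdrawn by its author, note of 2024-04-18).
HONEST FRAMING: the VALUE is a THEOREM / DECIDABLE VERDICT / CERTIFICATE / precise negative result — NOT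
summit progress.  Theorems about a WITHDRAWN algorithm: they certify the exact content of Lemma 3.27–3.28
(where Cond. C.1 enters, and Cond. C.5 a second time) for EVERY pair of measurement outcomes `(z′, h*)`;
nothing is repaired, nothing is broken, no cryptanalytic claim (the defect of the paper is the periodicity
premise of Lemma 2.17 in Step 9, `ChenQuantumLWESteps`).  The `≈_t` statements (Lemma 3.29), the `2^{−Ω(n)}`
tails and all truncations are NOT treated.  No named fact is introduced (debt 0).
-/
import Literature.Computability.Cryptography.ChenQuantumLWEStepSix

/-!
# Chen 2024, Lemma 3.27–3.28: the comb along `x` in `|φ₆⟩`, exactly (1-D Poisson summation only)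

Setting (§3.5.6 p. 27–29; Cond. C.1–C.2, C.5–C.6 p. 18–19).  `phi6_karst` (Step 6, `κ = 1`) writes `|φ₆⟩(c)`
as a series over the line index `k ∈ ℤ` of products of 1-D dual Gaussians of rate `1/β`, `β := bM² + 2i`
(`= σ²/N²` under C.5, `rate_shift_of_C5`).  For `M = 2N` (C.2) the dual centres are `(kxᵢ + gᵢ)/N` with
`g := c̃ + z′ + h̃* − y`, so the product over the coordinates is ONE Gaussian ball series over `Ξ ∈ ℤⁿ`,
`ballSum`, a function of the integer vector `NΞ + kx + g` alone.  The paper's line is `x = D·b` and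
`N = (c+1)D²‖b‖²` is a multiple of `D` (C.1–C.2); put `L := N/D`.  Then `L·x = N·b`, so the ball series is
`L`-PERIODIC in the line index (`ballSum_add_period`: the classes `(k + L, Ξ − b)` and `(k, Ξ)` give the same
ball), and summing the `k`-series by residues mod `L` (`tsum_mul_periodic_eq_sum_residue`) gives

  `|φ₆⟩(c) = Mⁿ·(prefactor)·Σ_{k₀ mod L} ballSum(k₀) · Σ_{ℓ∈ℤ} e^{−πa‖(k₀+Lℓ)x − y‖²} e(⟨(k₀+Lℓ)x − y + h̃*, c̃⟩/P)`

(`phi6_classes`): finitely many balls of width `σ` per period, each weighted by a CLASS SUM — a 1-D complex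
Gaussian series in `ℓ` of rate `A := a‖x‖²L²` twisted by `e(ℓ⟨b,c̃⟩/M)`.  Its imaginary part `‖x‖²L²/s²`
is, under C.5, `U′ − U′s⁴/(s⁴+r⁴)` with `U′ := t²/(2D²)` (`classRate_of_C5`), and C.1 (`t² = c‖x‖²`,
`c ∈ 4ℤ`) makes `U′` an EVEN integer: so the chirp `e^{−πiU′ℓ²} = 1` can be removed before Poisson summation
in `ℓ` (`tsum_cexp_neg_quadratic_chirp`, `step2_tsum_exact_chirp` — the same mechanism as C.5's
`e^{2πi‖J‖²} = 1` one step earlier), leaving the tiny rate `‖x‖²L²/r² − iU′s⁴/(s⁴+r⁴)` and hence a SHARP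
selector in the dual variable: `phi6_comb`, the exact form of eq. (64)–(72).  Which classes are lit is read
off at the ball centres (`comb_selector_at_centre`): class `(k₀, Ξ)` has selector phase
`(k₀ + ⟨Ξ,x⟩ + e₀)/(2D)` with `e₀ = ⟨x, z′+h̃*⟩/N − ⟨x,y⟩/‖x‖²` — i.e. exactly the centres
`(M/2)k_c − (z′+h*−y) − x⟨x,k_c⟩ + 2Djx + x·e₀` of eq. (29) = (75) (`k_c = −Ξ`, `2Dj = −(k₀ + ⟨Ξ,x⟩ + k′)`),
and along the line the product of the two Gaussian factors is a Gaussian centred at the shift `e₀·x` with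
parallel variance `σ²t²/N` times the outcome weight `e^{−πe₀²N/σ²}` (`comb_profile_sq`, eq. (74)).

Results (exact; every constant explicit; no `≈`):
* `tsum_cexp_neg_quadratic_chirp` — for `Re A > 0`, `κ ∈ ℤ`, `c₀, w ∈ ℂ`: `e^{−2πiκk²} = 1` on `ℤ`, so
  `Σ_k e^{−πA(k−c₀)²} e^{−2πikw} = e^{2πiκc₀²} (A+2κi)^{−1/2} Σ_j e^{−π(j+w+2κc₀)²/(A+2κi)} e^{−2πic₀(j+w+2κc₀)}`.
* `step2_tsum_exact_chirp` — eq. (18) (`step2_tsum_exact`) with an even chirp removed: dual rate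
  `1/(a‖x‖² + 2κi)`, dual centre shifted by `2κ⟨x,y⟩/‖x‖²`.
* `ballSum`, `ballSum_add_period` — the ball series and its `L`-periodicity in the line index (`Lx = Nb`).
* `prod_dual_eq_ballSum`, `phi6_karst_ballSum` — `phi6_karst` at `κ = 1`, `M = 2N`, with the coordinate
  product assembled into `ballSum` (`prod_tsum_int`).
* `tsum_mul_periodic_eq_sum_residue` — `Σ_k A(k)T(k) = Σ_{k₀ mod L} T(k₀) Σ_ℓ A(k₀ + Lℓ)` for `L`-periodic `T`;
  `summable_line_mul_ballSum` — the summability it needs here (`summable_uncurry_mul_prod`).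
* `classSum`, `phi6_classes` — `|φ₆⟩(c)` as a finite sum over line classes `k₀ mod L` of
  (ball series) × (class sum).
* `classSum_reindex`, `lineClass_dots`, `phi6_comb` — the class sums Poisson-resummed after the chirp trade by
  `κ′ ∈ ℤ` (read `2κ′ = −t²/(2D²)`): the exact counterpart of eq. (64)–(72) (Lemma 3.27).
* `classRate_of_C5`, `four_mul_sq_dvd_of_C1` — the algebra of C.5/C.1 behind the choice `κ′ = −t²/(4D²)`.
* `comb_selector_at_centre` — the dictionary with eq. (29) = (75) (Lemma 3.28), scalar shadow.
* `comb_profile_sq` — completing the square along the line: centre shift `e₀x`, parallel variance `σ²t²/N`,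
  outcome weight `e^{−πe₀²N/σ²}` (eq. (74)), scalar shadow.

[cite: ChenQuantumLattice2024, §3.5.6 Lemma 3.27–3.28, eq. (27)–(29), p. 27–29; §3.6.4 eq. (56)–(75) p. 52–56;
Cond. C.1–C.2, C.5–C.6 p. 18–19; Lemma 2.4 p. 10; §1.2 eq. (1)–(2) p. 3–4]
-/

namespace Literature.Computability.Cryptography.Chen2024

open scoped BigOperators Real
open Complex hiding exp continuous_exp exp_add

noncomputable section

section Lemma327

variable {n : ℕ}

/-! ### One-dimensional Poisson summation after removing an even chirp -/

/-- **Chirp trade + Poisson summation in one variable.**  For `Re A > 0`, `κ ∈ ℤ` and all `c₀, w ∈ ℂ`: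
since `e^{−2πiκk²} = 1` for `k ∈ ℤ`, the rate `A` of `k ↦ e^{−πA(k−c₀)²}` may be traded for `A + 2κi` on the
integers (extra character `e^{−2πik·2κc₀}`, constant `e^{2πiκc₀²}`), and then the master identity
`tsum_cexp_neg_quadratic_shift` (Lemma 2.4 + eq. (1)) gives
`Σ_{k∈ℤ} e^{−πA(k−c₀)²} e^{−2πikw}
   = e^{2πiκc₀²} (A+2κi)^{−1/2} Σ_{j∈ℤ} e^{−(π/(A+2κi))(j + w + 2κc₀)²} e^{−2πic₀(j + w + 2κc₀)}`.
This is the one-variable form of the mechanism behind Cond. C.5 (`tsum_lattice_gauss_char_shift`); in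
Lemma 3.27 it is used a second time, along the line, with `2κ = −t²/(2D²) ∈ 2ℤ` (Cond. C.1, eq. (67)–(68)).
[cite: ChenQuantumLattice2024, Lemma 2.4 p. 10; §1.2 eq. (1)–(2) p. 3; eq. (67)–(68) p. 53–54; Cond. C.1 p. 18] -/
theorem tsum_cexp_neg_quadratic_chirp {A : ℂ} (hA : 0 < A.re) (c₀ w : ℂ) (κ : ℤ) :
    ∑' k : ℤ, cexp (-π * A * (k - c₀) ^ 2) * cexp (-2 * π * I * k * w)
      = cexp (2 * π * I * κ * c₀ ^ 2) * (1 / (A + 2 * κ * I) ^ (1 / 2 : ℂ)) *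
        ∑' j : ℤ, cexp (-π / (A + 2 * κ * I) * (j + (w + 2 * κ * c₀)) ^ 2) *
          cexp (-2 * π * I * c₀ * (j + (w + 2 * κ * c₀))) := by
  have hA' : 0 < (A + 2 * κ * I).re := by simpa using hA
  have hterm : ∀ k : ℤ, cexp (-π * A * (k - c₀) ^ 2) * cexp (-2 * π * I * k * w)
      = cexp (2 * π * I * κ * c₀ ^ 2) *
        (cexp (-π * (A + 2 * κ * I) * (k - c₀) ^ 2) * cexp (-2 * π * I * k * (w + 2 * κ * c₀))) := by
    intro k
    rw [← Complex.exp_add, ← Complex.exp_add, ← Complex.exp_add]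
    refine Complex.exp_eq_exp_iff_exists_int.mpr ⟨κ * k ^ 2, ?_⟩
    push_cast
    ring
  simp_rw [hterm]
  rw [tsum_mul_left, tsum_cexp_neg_quadratic_shift hA' c₀ (w + 2 * κ * c₀), ← mul_assoc]

/-- **Eq. (18) with an even chirp removed along the line.**  For `Re a > 0`, `x ≠ 0`, `y, z ∈ ℤⁿ`, `P ≥ 1`
and ANY `κ ∈ ℤ`: completing the square in `k` (`‖kx−y‖² = ‖x‖²(k − c_y)² + ‖y‖² − ⟨x,y⟩²/‖x‖²`,
`c_y = ⟨x,y⟩/‖x‖²`) and `tsum_cexp_neg_quadratic_chirp` with rate `a‖x‖²`: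
`Σ_k e^{−πa‖kx−y‖²} e^{−2πi⟨kx−y,z⟩/P} = e^{−πa(‖y‖² − ⟨x,y⟩²/‖x‖²)} e^{2πi⟨y,z⟩/P} e^{2πiκc_y²} (a‖x‖²+2κi)^{−1/2}
   · Σ_j e^{−(π/(a‖x‖²+2κi))(j + ⟨x,z⟩/P + 2κc_y)²} e^{−2πic_y(j + ⟨x,z⟩/P + 2κc_y)}`;
`κ = 0` is `step2_tsum_exact`.  Used for the class sums of Lemma 3.27 with the line `L·x` and
`2κ = −t²/(2D²)` (eq. (64)–(68)). [cite: ChenQuantumLattice2024, eq. (18) p. 24; eq. (64)–(68) p. 52–54] -/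
theorem step2_tsum_exact_chirp {a : ℂ} (ha : 0 < a.re) {x : Fin n → ℤ} (hx : x ≠ 0) (y z : Fin n → ℤ)
    {P : ℕ} (hP : P ≠ 0) (κ : ℤ) :
    ∑' k : ℤ, cexp (-π * a * ∑ i, ((k * x i - y i : ℤ) : ℂ) ^ 2) *
        cexp (-2 * π * I * ((∑ i, (k * x i - y i) * z i : ℤ) : ℂ) / P)
      = cexp (-π * a * (((y ⬝ᵥ y : ℤ) : ℂ) - ((x ⬝ᵥ y : ℤ) : ℂ) ^ 2 / ((x ⬝ᵥ x : ℤ) : ℂ))) *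
        cexp (2 * π * I * ((y ⬝ᵥ z : ℤ) : ℂ) / P) *
        (cexp (2 * π * I * κ * (((x ⬝ᵥ y : ℤ) : ℂ) / ((x ⬝ᵥ x : ℤ) : ℂ)) ^ 2) *
          (1 / (a * ((x ⬝ᵥ x : ℤ) : ℂ) + 2 * κ * I) ^ (1 / 2 : ℂ))) *
        ∑' j : ℤ, cexp (-π / (a * ((x ⬝ᵥ x : ℤ) : ℂ) + 2 * κ * I)
              * (j + (((x ⬝ᵥ z : ℤ) : ℂ) / P + 2 * κ * (((x ⬝ᵥ y : ℤ) : ℂ) / ((x ⬝ᵥ x : ℤ) : ℂ)))) ^ 2) *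
          cexp (-2 * π * I * (((x ⬝ᵥ y : ℤ) : ℂ) / ((x ⬝ᵥ x : ℤ) : ℂ))
              * (j + (((x ⬝ᵥ z : ℤ) : ℂ) / P + 2 * κ * (((x ⬝ᵥ y : ℤ) : ℂ) / ((x ⬝ᵥ x : ℤ) : ℂ))))) := by
  have hA := re_mul_dotProduct_self_pos ha hx
  have hX0 : ((x ⬝ᵥ x : ℤ) : ℂ) ≠ 0 := fun h => by simp [h] at hA
  have hP' : (P : ℂ) ≠ 0 := by exact_mod_cast hP
  have hterm : ∀ k : ℤ, cexp (-π * a * ∑ i, ((k * x i - y i : ℤ) : ℂ) ^ 2) *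
        cexp (-2 * π * I * ((∑ i, (k * x i - y i) * z i : ℤ) : ℂ) / P)
      = (cexp (-π * a * (((y ⬝ᵥ y : ℤ) : ℂ) - ((x ⬝ᵥ y : ℤ) : ℂ) ^ 2 / ((x ⬝ᵥ x : ℤ) : ℂ))) *
          cexp (2 * π * I * ((y ⬝ᵥ z : ℤ) : ℂ) / P)) *
        (cexp (-π * (a * ((x ⬝ᵥ x : ℤ) : ℂ)) * (k - ((x ⬝ᵥ y : ℤ) : ℂ) / ((x ⬝ᵥ x : ℤ) : ℂ)) ^ 2) *
          cexp (-2 * π * I * k * (((x ⬝ᵥ z : ℤ) : ℂ) / P))) := by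
    intro k
    have e1 : (∑ i, ((k * x i - y i : ℤ) : ℂ) ^ 2)
        = (k : ℂ) ^ 2 * ((x ⬝ᵥ x : ℤ) : ℂ) - 2 * k * ((x ⬝ᵥ y : ℤ) : ℂ) + ((y ⬝ᵥ y : ℤ) : ℂ) := by
      push_cast
      exact sum_sq_line x y k
    have e2 : ((∑ i, (k * x i - y i) * z i : ℤ) : ℂ) = (k : ℂ) * ((x ⬝ᵥ z : ℤ) : ℂ) - ((y ⬝ᵥ z : ℤ) : ℂ) := by
      push_cast
      exact sum_line_mul x y z k
    rw [e1, e2, ← Complex.exp_add, ← Complex.exp_add, ← Complex.exp_add, ← Complex.exp_add]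
    congr 1
    field_simp
    ring
  simp_rw [hterm]
  rw [tsum_mul_left, tsum_cexp_neg_quadratic_chirp hA _ _ κ]
  ring

/-! ### The ball series and its periodicity in the line index -/

/-- **The ball series of `|φ₆⟩`.**  For a rate `β`, moduli `N, M`, integer vectors `w` (twist), `g` (offset),
`x` (line) and a line index `k`:
`ballSum β N M w g x k := Σ_{Ξ∈ℤⁿ} ∏ᵢ e^{−(π/β)((NΞᵢ + kxᵢ + gᵢ)/N)²} · e^{−2πi(wᵢ/M)(NΞᵢ + kxᵢ + gᵢ)/N}`
— the coordinate product of `phi6_karst`'s dual Gaussians for `M = 2N`, assembled into one series over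
`ℤⁿ`: a function of the integer vector `NΞ + kx + g` only.  Under C.5 (`β = σ²/N²`, real) its terms are the
"Gaussian balls of width `σ`" of eq. (27)–(29), centred at `c̃ = −(z′ + h̃* − y) − kx − NΞ`.
[cite: ChenQuantumLattice2024, eq. (27)–(29) p. 27–29; Lemma 3.28 p. 55] -/
def ballSum (β : ℂ) (N M : ℕ) (w g x : Fin n → ℤ) (k : ℤ) : ℂ :=
  ∑' Ξ : Fin n → ℤ, ∏ i,
    (cexp (-π / β * ((((N : ℤ) * Ξ i + k * x i + g i : ℤ) : ℂ) / N) ^ 2) *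
      cexp (-2 * π * I * (((w i : ℤ) : ℂ) / M) * ((((N : ℤ) * Ξ i + k * x i + g i : ℤ) : ℂ) / N)))

/-- **Periodicity of the ball series in the line index.**  If the line is `x = D·b` and `N = L·D`, then
`L·x = N·b`, so `NΞ + (k+L)x + g = N(Ξ + b) + kx + g` and reindexing `Ξ ↦ Ξ + b` gives
`ballSum(k + L) = ballSum(k)`: the pairs `(k, Ξ)` and `(k + L, Ξ − b)` label the SAME ball.  (For the paper's
parameters `x = D·b`, `N = t² + ‖x‖² = (c+1)D²‖b‖²`, Cond. C.1–C.2, so `L = (c+1)D‖b‖²`.)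
[cite: ChenQuantumLattice2024, Cond. C.1–C.2 p. 18; §3.3 p. 18 (`x := D·b`); eq. (60)–(64) p. 52–53] -/
theorem ballSum_add_period (β : ℂ) (N M : ℕ) (w g : Fin n → ℤ) {x b : Fin n → ℤ} {L D : ℤ}
    (hxb : ∀ i, x i = D * b i) (hN : (N : ℤ) = L * D) (k : ℤ) :
    ballSum β N M w g x (k + L) = ballSum β N M w g x k := by
  unfold ballSum
  set F : (Fin n → ℤ) → ℂ := fun Ξ => ∏ i,
    (cexp (-π / β * ((((N : ℤ) * Ξ i + k * x i + g i : ℤ) : ℂ) / N) ^ 2) *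
      cexp (-2 * π * I * (((w i : ℤ) : ℂ) / M) * ((((N : ℤ) * Ξ i + k * x i + g i : ℤ) : ℂ) / N))) with hF
  have hpt : ∀ (Ξ : Fin n → ℤ) (i : Fin n),
      ((N : ℤ) * Ξ i + (k + L) * x i + g i : ℤ) = ((N : ℤ) * (Ξ + b) i + k * x i + g i : ℤ) := by
    intro Ξ i
    simp only [Pi.add_apply]
    rw [hxb i, hN]
    ring
  calc ∑' Ξ : Fin n → ℤ, ∏ i,
        (cexp (-π / β * ((((N : ℤ) * Ξ i + (k + L) * x i + g i : ℤ) : ℂ) / N) ^ 2) *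
          cexp (-2 * π * I * (((w i : ℤ) : ℂ) / M) * ((((N : ℤ) * Ξ i + (k + L) * x i + g i : ℤ) : ℂ) / N)))
      = ∑' Ξ : Fin n → ℤ, F (Equiv.addRight b Ξ) := by
        refine tsum_congr fun Ξ => ?_
        simp only [hF, Equiv.coe_addRight]
        exact Finset.prod_congr rfl fun i _ => by rw [hpt Ξ i]
    _ = ∑' Ξ : Fin n → ℤ, F Ξ := (Equiv.addRight b).tsum_eq F


/-! ### `|φ₆⟩` at `κ = 1`, `M = 2N`: the coordinate product as one ball series -/

/-- Cast bookkeeping for `M = 2N`: the dual centre `ξ + s/N + 2w/M` of `phi6_karst` (at `κ = 1`) is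
`(Nξ + kx + g)/N` once `s + w = kx + g`. [folklore] -/
private theorem dual_centre_cast {N M : ℕ} [NeZero N] (hM : (M : ℂ) = 2 * (N : ℂ)) {s w x g : ℤ} {k : ℤ}
    (hg : s + w = k * x + g) (ξ : ℤ) :
    (ξ : ℂ) + (((s : ℤ) : ℂ) / N + 2 * ((w : ℤ) : ℂ) / M) = (((N : ℤ) * ξ + k * x + g : ℤ) : ℂ) / N := by
  have hN : (N : ℂ) ≠ 0 := by exact_mod_cast NeZero.ne N
  have hgi : ((s : ℤ) : ℂ) + ((w : ℤ) : ℂ) = (k : ℂ) * (x : ℂ) + (g : ℂ) := by exact_mod_cast hg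
  rw [hM, mul_div_mul_left _ _ (two_ne_zero' ℂ), ← add_div, hgi]
  push_cast
  field_simp
  ring


/-- `Re(bM² + 2i) = Re b · M² > 0` for `M ≥ 1`. [folklore] -/
private theorem re_rate_two_pos {b : ℂ} (hb : 0 < b.re) (M : ℕ) [NeZero M] :
    0 < (b * (M : ℂ) ^ 2 + 2 * I).re := by
  have h1 : (b * (M : ℂ) ^ 2 + 2 * I).re = b.re * (M : ℝ) ^ 2 := by
    rw [Complex.add_re, show ((M : ℂ) ^ 2) = (((M : ℝ) ^ 2 : ℝ) : ℂ) by push_cast; ring,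
      Complex.re_mul_ofReal]
    simp
  rw [h1]
  exact mul_pos hb (pow_pos (Nat.cast_pos.mpr (Nat.pos_of_ne_zero (NeZero.ne M))) 2)

/-- `Re(1/β) > 0` for `Re β > 0`. [folklore] -/
private theorem one_div_re_pos {β : ℂ} (hβ : 0 < β.re) : 0 < (1 / β).re := by
  have hβ0 : β ≠ 0 := fun h => by simp [h] at hβ
  rw [one_div, Complex.inv_re]
  exact div_pos hβ (Complex.normSq_pos.mpr hβ0)

/-- The modulus of one factor of the ball series: `|e^{−(π/β)((Nj+m)/N)²} e^{−2πi(w/M)(Nj+m)/N}| =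
e^{−π Re(1/β) (j + m/N)²}` (`m = kxᵢ + gᵢ`). [folklore] -/
private theorem norm_ball_factor (β : ℂ) (N M : ℕ) [NeZero N] (w m j : ℤ) :
    ‖cexp (-π / β * ((((N : ℤ) * j + m : ℤ) : ℂ) / N) ^ 2) *
        cexp (-2 * π * I * (((w : ℤ) : ℂ) / M) * ((((N : ℤ) * j + m : ℤ) : ℂ) / N))‖
      = Real.exp (-π * (1 / β).re * ((j : ℝ) + (m : ℝ) / N) ^ 2) := by
  have hN : (N : ℂ) ≠ 0 := by exact_mod_cast NeZero.ne N
  have hX : (((N : ℤ) * j + m : ℤ) : ℂ) / N = (((j : ℝ) + (m : ℝ) / N : ℝ) : ℂ) := by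
    push_cast
    field_simp
  rw [norm_mul, hX, show -2 * π * I * (((w : ℤ) : ℂ) / M) * ((((j : ℝ) + (m : ℝ) / N : ℝ)) : ℂ)
      = ((-2 * π * ((w : ℝ) / M) * ((j : ℝ) + (m : ℝ) / N) : ℝ) : ℂ) * I by push_cast; ring,
    Complex.norm_exp_ofReal_mul_I, mul_one, Complex.norm_exp,
    show -π / β * ((((j : ℝ) + (m : ℝ) / N : ℝ)) : ℂ) ^ 2
      = (((-π * ((j : ℝ) + (m : ℝ) / N) ^ 2 : ℝ)) : ℂ) * (1 / β) by push_cast; ring,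
    re_ofReal_mul]
  ring

/-- **The coordinate product of `phi6_karst` (at `κ = 1`, `M = 2N`) is the ball series.**  For `Re β > 0`,
`(M : ℂ) = 2N` and integer data with `sᵢ + wᵢ = kxᵢ + gᵢ`:
`∏ᵢ Σ_{ξ∈ℤ} e^{−(π/β)(ξ + sᵢ/N + 2wᵢ/M)²} e^{−2πi(wᵢ/M)(ξ + sᵢ/N + 2wᵢ/M)} = ballSum β N M w g x k`
(product of absolutely convergent series = series over `ℤⁿ`, `prod_tsum_int`; then `ξ + sᵢ/N + wᵢ/N =
(Nξ + kxᵢ + gᵢ)/N`). [cite: ChenQuantumLattice2024, eq. (27) p. 27–28; Cond. C.2 p. 18] -/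
theorem prod_dual_eq_ballSum {β : ℂ} (hβ : 0 < β.re) {N M : ℕ} [NeZero N] (hM : (M : ℂ) = 2 * (N : ℂ))
    (w s g x : Fin n → ℤ) (k : ℤ) (hg : ∀ i, s i + w i = k * x i + g i) :
    ∏ i, ∑' ξ : ℤ, cexp (-π / β * (ξ + (((s i : ℤ) : ℂ) / N + 2 * ((w i : ℤ) : ℂ) / M)) ^ 2) *
        cexp (-2 * π * I * (((w i : ℤ) : ℂ) / M) * (ξ + (((s i : ℤ) : ℂ) / N + 2 * ((w i : ℤ) : ℂ) / M)))
      = ballSum β N M w g x k := by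
  have hc : ∀ (i : Fin n) (ξ : ℤ), (ξ : ℂ) + (((s i : ℤ) : ℂ) / N + 2 * ((w i : ℤ) : ℂ) / M)
      = ((((N : ℤ) * ξ + (k * x i + g i) : ℤ) : ℂ)) / N := fun i ξ => by
    rw [dual_centre_cast hM (hg i) ξ, add_assoc]
  set f : Fin n → ℤ → ℂ := fun i ξ =>
    cexp (-π / β * ((((N : ℤ) * ξ + (k * x i + g i) : ℤ) : ℂ) / N) ^ 2) *
      cexp (-2 * π * I * (((w i : ℤ) : ℂ) / M) * ((((N : ℤ) * ξ + (k * x i + g i) : ℤ) : ℂ) / N)) with hf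
  have hfn : ∀ i, Summable fun ξ : ℤ => ‖f i ξ‖ := by
    intro i
    obtain ⟨Θ, hΘ⟩ := exists_theta_bound (one_div_re_pos hβ)
    refine (hΘ (((k * x i + g i : ℤ) : ℝ) / N)).1.congr fun ξ => ?_
    rw [hf, norm_ball_factor]
  have hlhs : ∀ i, (∑' ξ : ℤ, cexp (-π / β * (ξ + (((s i : ℤ) : ℂ) / N + 2 * ((w i : ℤ) : ℂ) / M)) ^ 2) *
        cexp (-2 * π * I * (((w i : ℤ) : ℂ) / M) * (ξ + (((s i : ℤ) : ℂ) / N + 2 * ((w i : ℤ) : ℂ) / M))))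
      = ∑' ξ : ℤ, f i ξ := fun i => tsum_congr fun ξ => by rw [hc i ξ]
  rw [Finset.prod_congr rfl fun i _ => hlhs i, (prod_tsum_int n f hfn).2]
  unfold ballSum
  refine tsum_congr fun Ξ => Finset.prod_congr rfl fun i _ => ?_
  rw [hf, add_assoc]

/-- **`|φ₆⟩` as a line series of ball series (Step 6 at `κ = 1`, `M = 2N`, Cond. C.2).**  With
`β := bM² + 2i`, `w := c̃ + z′`, `g := c̃ + z′ + h̃* − y`:
`|φ₆⟩(c) = Mⁿ · e^{2πi Σ(wᵢ/M)²} β^{−n/2} · Σ_{k∈ℤ} e^{−πa‖kx−y‖²} e(⟨kx−y+h̃*, c̃⟩/P) · ballSum β N M w g x k`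
— `phi6_karst` with the coordinate product assembled by `prod_dual_eq_ballSum`.  Under C.5 (`β = σ²/N²`,
`rate_shift_of_C5`) each term of `ballSum` is the ball `e^{−π‖c̃ + (z′+h̃*−y) + kx + NΞ‖²/σ²}` of eq. (27):
width `σ` in EVERY direction, centred on the coset `−(z′+h̃*−y) − kx + Nℤⁿ` of the line.
[cite: ChenQuantumLattice2024, eq. (27)–(28) p. 27–28; Cond. C.2, C.5 p. 18–19] -/
theorem phi6_karst_ballSum {P M N : ℕ} [NeZero P] [NeZero M] [NeZero N] (hP : P = M * N) (hM : M = 2 * N)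
    {a b : ℂ} (ha : 0 < a.re) (hb : 0 < b.re) {x : Fin n → ℤ} (hx : x ≠ 0) (y z' : Fin n → ℤ)
    (hs : Fin n → ZMod N) (c : Fin n → ZMod M) :
    phi6 P N a b x y z' hs c
      = (M : ℂ) ^ n * (cexp (2 * π * I * ∑ i, ((((((c i).val : ℤ) + z' i : ℤ)) : ℂ) / M) ^ 2) *
          (1 / (b * (M : ℂ) ^ 2 + 2 * I) ^ (1 / 2 : ℂ)) ^ n) *
        ∑' k : ℤ, cexp (-π * a * ∑ i, ((k * x i - y i : ℤ) : ℂ) ^ 2) *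
          e ((((∑ i, (k * x i - y i + (hs i).val) * ((c i).val : ℤ) : ℤ)) : ℚ) / P) *
          ballSum (b * (M : ℂ) ^ 2 + 2 * I) N M (fun i => ((c i).val : ℤ) + z' i)
            (fun i => ((c i).val : ℤ) + z' i + (hs i).val - y i) x k := by
  have hβ := re_rate_two_pos hb M
  have hM' : (M : ℂ) = 2 * (N : ℂ) := by exact_mod_cast hM
  rw [phi6_karst hP ha hb hx y z' hs c 1]
  simp only [Int.cast_one, mul_one]
  congr 1
  refine tsum_congr fun k => ?_
  congr 1
  exact prod_dual_eq_ballSum hβ hM' (fun i => ((c i).val : ℤ) + z' i) (fun i => k * x i - y i + (hs i).val)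
    (fun i => ((c i).val : ℤ) + z' i + (hs i).val - y i) x k (fun i => by ring)

/-! ### Regrouping the line series by classes modulo the period -/

/-- **Residue regrouping against a periodic factor.**  If `T : ℤ → ℂ` is `L`-periodic and `Σ_k A(k)T(k)`
converges absolutely enough to be summed by residues (`tsum_int_eq_sum_residue`), then
`Σ_{k∈ℤ} A(k)T(k) = Σ_{k₀ mod L} T(k₀) · Σ_{ℓ∈ℤ} A(k₀ + Lℓ)` — the regrouping of the line index into
classes modulo the period used in eq. (60)–(64). [cite: ChenQuantumLattice2024, §3.6.4 eq. (60)–(64) p. 52–53] -/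
theorem tsum_mul_periodic_eq_sum_residue (L : ℕ) [NeZero L] {A T : ℤ → ℂ}
    (hT : Function.Periodic T (L : ℤ)) (hAT : Summable fun k => A k * T k) :
    ∑' k : ℤ, A k * T k = ∑ k₀ : ZMod L, T (k₀.val : ℤ) * ∑' ℓ : ℤ, A ((k₀.val : ℤ) + L * ℓ) := by
  rw [tsum_int_eq_sum_residue L hAT]
  refine Finset.sum_congr rfl fun k₀ _ => ?_
  have hper : ∀ ℓ : ℤ, T ((k₀.val : ℤ) + L * ℓ) = T (k₀.val : ℤ) := fun ℓ => by
    have h := hT.int_mul ℓ (k₀.val : ℤ)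
    rwa [mul_comm] at h
  simp_rw [hper]
  rw [tsum_mul_right, mul_comm]

/-- Summability of the line series of `phi6_karst_ballSum` (line window absolutely summable, character
unimodular, ball series uniformly bounded — `summable_uncurry_mul_prod` + `exists_theta_bound`): the absolute
convergence of the series (27) that licenses the regrouping (60)–(64).
[cite: ChenQuantumLattice2024, eq. (27) p. 27–28; §3.6.4 eq. (60)–(64) p. 52–53] -/
theorem summable_line_mul_ballSum {β a : ℂ} (hβ : 0 < β.re) (ha : 0 < a.re) (N M P : ℕ) [NeZero N]
    {x : Fin n → ℤ} (hx : x ≠ 0) (y w g v : Fin n → ℤ) (u : Fin n → ℤ) :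
    Summable fun k : ℤ => cexp (-π * a * ∑ i, ((k * x i - y i : ℤ) : ℂ) ^ 2) *
      e ((((∑ i, (k * x i - y i + v i) * u i : ℤ)) : ℚ) / P) * ballSum β N M w g x k := by
  set F : ℤ → ℂ := fun k => cexp (-π * a * ∑ i, ((k * x i - y i : ℤ) : ℂ) ^ 2) *
      e ((((∑ i, (k * x i - y i + v i) * u i : ℤ)) : ℚ) / P) with hF
  set G : ℤ → Fin n → ℤ → ℂ := fun k i j =>
    cexp (-π / β * ((((N : ℤ) * j + (k * x i + g i) : ℤ) : ℂ) / N) ^ 2) *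
      cexp (-2 * π * I * (((w i : ℤ) : ℂ) / M) * ((((N : ℤ) * j + (k * x i + g i) : ℤ) : ℂ) / N)) with hG
  have hFs : Summable F := by
    refine Summable.of_norm ((summable_lineWindow ha hx y).norm.congr fun k => ?_)
    rw [hF]
    simp only [norm_mul, norm_e, mul_one]
  obtain ⟨Θ, hΘ⟩ := exists_theta_bound (one_div_re_pos hβ)
  have hnorm : ∀ (k : ℤ) (i : Fin n) (j : ℤ),
      ‖G k i j‖ = Real.exp (-π * (1 / β).re * ((j : ℝ) + ((k * x i + g i : ℤ) : ℝ) / N) ^ 2) := by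
    intro k i j
    rw [hG, norm_ball_factor]
  have hGs : ∀ k i, Summable fun j => ‖G k i j‖ := fun k i => by
    simp_rw [hnorm]
    exact (hΘ _).1
  have hGΘ : ∀ k i, ∑' j, ‖G k i j‖ ≤ Θ := fun k i => by
    simp_rw [hnorm]
    exact (hΘ _).2
  have hU := summable_uncurry_mul_prod hFs hGs hGΘ
  refine hU.prod.congr fun k => ?_
  simp only [Function.uncurry]
  rw [tsum_mul_left, hF, hG]
  unfold ballSum
  simp only [add_assoc]

/-- **The class sum.**  For a line class `k₀ mod L` the teeth `k = k₀ + Lℓ`, `ℓ ∈ ℤ`, of `phi6_karst`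
carry the total amplitude
`classSum a P x y v u L k₀ := Σ_{ℓ∈ℤ} e^{−πa‖(k₀+Lℓ)x − y‖²} · e(⟨(k₀+Lℓ)x − y + v, u⟩/P)`
(`v = h̃*`, `u = c̃` read in `[0,N)`, `[0,M)`): a one-dimensional complex Gaussian series in `ℓ` of rate
`a‖x‖²L²` twisted by the character `ℓ ↦ e(ℓL⟨x,u⟩/P) = e(ℓ⟨b₀,u⟩/M)` — the object of eq. (64)–(68).
[cite: ChenQuantumLattice2024, §3.6.4 eq. (64)–(68) p. 52–54] -/
def classSum (a : ℂ) (P : ℕ) (x y v u : Fin n → ℤ) (L : ℕ) (k₀ : ℤ) : ℂ :=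
  ∑' ℓ : ℤ, cexp (-π * a * ∑ i, ((((k₀ + L * ℓ) * x i - y i : ℤ)) : ℂ) ^ 2) *
    e ((((∑ i, ((k₀ + L * ℓ) * x i - y i + v i) * u i : ℤ)) : ℚ) / P)

/-- **`|φ₆⟩` regrouped by line classes (Lemma 3.27, structure).**  Hypotheses: `P = MN`, `M = 2N` (C.2),
the line `x = D·b₀` and `N = L·D` (for the paper `N = (c+1)D²‖b₀‖²`, C.1–C.2, `L = (c+1)D‖b₀‖²`).  Then with
`β := bM² + 2i`, `w := c̃ + z′`, `g := c̃ + z′ + h̃* − y`: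
`|φ₆⟩(c) = Mⁿ e^{2πiΣ(wᵢ/M)²} β^{−n/2} · Σ_{k₀ ∈ ℤ_L} ballSum(k₀) · Σ_{ℓ∈ℤ} e^{−πa‖(k₀+Lℓ)x − y‖²} e(⟨(k₀+Lℓ)x − y + h̃*, c̃⟩/P)`.
Reading: per period `L` of the line index there are `L · #{Ξ}` distinct balls (all of width `σ` under C.5);
the teeth `(k₀ + Lℓ, Ξ − ℓb₀)`, `ℓ ∈ ℤ`, are ONE ball, whose total amplitude is the CLASS SUM over `ℓ` — a
one-dimensional complex Gaussian series of rate `a‖x‖²L²` (huge imaginary part `‖x‖²L²/s² ≈ t²/(2D²)`),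
which is where Cond. C.1 enters (`phi6_comb`).
[cite: ChenQuantumLattice2024, §3.5.6 Lemma 3.27 p. 28; §3.6.4 eq. (60)–(66) p. 52–53; Cond. C.1–C.2 p. 18] -/
theorem phi6_classes {P M N L D : ℕ} [NeZero P] [NeZero M] [NeZero N] [NeZero L] (hP : P = M * N)
    (hM : M = 2 * N) (hN : N = L * D) {a b : ℂ} (ha : 0 < a.re) (hb : 0 < b.re) {x : Fin n → ℤ} (hx : x ≠ 0)
    (b₀ : Fin n → ℤ) (hxb : ∀ i, x i = D * b₀ i) (y z' : Fin n → ℤ) (hs : Fin n → ZMod N)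
    (c : Fin n → ZMod M) :
    phi6 P N a b x y z' hs c
      = (M : ℂ) ^ n * (cexp (2 * π * I * ∑ i, ((((((c i).val : ℤ) + z' i : ℤ)) : ℂ) / M) ^ 2) *
          (1 / (b * (M : ℂ) ^ 2 + 2 * I) ^ (1 / 2 : ℂ)) ^ n) *
        ∑ k₀ : ZMod L, ballSum (b * (M : ℂ) ^ 2 + 2 * I) N M (fun i => ((c i).val : ℤ) + z' i)
            (fun i => ((c i).val : ℤ) + z' i + (hs i).val - y i) x (k₀.val : ℤ) *
          classSum a P x y (fun i => ((hs i).val : ℤ)) (fun i => ((c i).val : ℤ)) L (k₀.val : ℤ) := by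
  have hβ := re_rate_two_pos hb M
  have hT : Function.Periodic (ballSum (b * (M : ℂ) ^ 2 + 2 * I) N M (fun i => ((c i).val : ℤ) + z' i)
      (fun i => ((c i).val : ℤ) + z' i + (hs i).val - y i) x) (L : ℤ) := fun k =>
    ballSum_add_period _ N M _ _ (D := (D : ℤ)) (fun i => by exact_mod_cast hxb i) (by exact_mod_cast hN) k
  rw [phi6_karst_ballSum hP hM ha hb hx y z' hs c]
  congr 1
  exact tsum_mul_periodic_eq_sum_residue L hT
    (summable_line_mul_ballSum hβ ha N M P hx y _ _ (fun i => ((hs i).val : ℤ)) (fun i => ((c i).val : ℤ)))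


/-! ### Poisson summation of the class sums after the chirp trade (Cond. C.1): the comb -/

/-- **Reindexing a class sum as a Step-2 line series.**  With the line `X := L·x`, the offset
`Y := y − k₀x` and the twist `Z := −u`: `(k₀+Lℓ)x − y = ℓX − Y` and
`e(⟨(k₀+Lℓ)x − y + v, u⟩/P) = e(⟨v,u⟩/P) · e^{−2πi⟨ℓX − Y, Z⟩/P}`, so
`classSum = e(⟨v,u⟩/P) · Σ_ℓ e^{−πa‖ℓX − Y‖²} e^{−2πi⟨ℓX−Y, Z⟩/P}` — the left side of eq. (18)
(`step2_tsum_exact`, `step2_tsum_exact_chirp`) for the data `(X, Y, Z)`.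
[cite: ChenQuantumLattice2024, eq. (18) p. 24; eq. (64) p. 52–53] -/
theorem classSum_reindex (a : ℂ) (P : ℕ) (x y v u : Fin n → ℤ) (L : ℕ) (k₀ : ℤ) :
    classSum a P x y v u L k₀ = e ((((∑ i, v i * u i : ℤ)) : ℚ) / P) *
      ∑' ℓ : ℤ, cexp (-π * a * ∑ i, ((ℓ * ((L : ℤ) • x) i - (y - k₀ • x) i : ℤ) : ℂ) ^ 2) *
        cexp (-2 * π * I * ((∑ i, (ℓ * ((L : ℤ) • x) i - (y - k₀ • x) i) * (-u) i : ℤ) : ℂ) / P) := by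
  unfold classSum
  rw [← tsum_mul_left]
  refine tsum_congr fun ℓ => ?_
  have h1 : ∀ i, ℓ * ((L : ℤ) • x) i - (y - k₀ • x) i = (k₀ + L * ℓ) * x i - y i := fun i => by
    simp only [Pi.smul_apply, Pi.sub_apply, smul_eq_mul]
    ring
  have h3 : (∑ i, (ℓ * ((L : ℤ) • x) i - (y - k₀ • x) i) * (-u) i) = -∑ i, ((k₀ + L * ℓ) * x i - y i) * u i := by
    rw [← Finset.sum_neg_distrib]
    exact Finset.sum_congr rfl fun i _ => by rw [h1, Pi.neg_apply]; ring
  have h2 : (∑ i, ((k₀ + L * ℓ) * x i - y i + v i) * u i) = (∑ i, v i * u i) + ∑ i, ((k₀ + L * ℓ) * x i - y i) * u i := by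
    rw [← Finset.sum_add_distrib]
    exact Finset.sum_congr rfl fun i _ => by ring
  rw [h3, h2]
  simp_rw [h1]
  simp only [e]
  push_cast
  rw [← Complex.exp_add, ← Complex.exp_add, ← Complex.exp_add]
  congr 1
  ring

/-- The dot products of the reindexed data `X = L·x`, `Y = y − k₀x`, `Z = −u` (dictionary for `phi6_comb`):
`‖X‖² = L²‖x‖²`, `⟨X,Y⟩ = L(⟨x,y⟩ − k₀‖x‖²)`, `⟨X,Z⟩ = −L⟨x,u⟩`, `⟨Y,Z⟩ = −⟨y,u⟩ + k₀⟨x,u⟩`,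
`‖Y‖² = ‖y‖² − 2k₀⟨x,y⟩ + k₀²‖x‖²` — the constants `S = ‖x‖²L²/r²`, `U = ‖x‖²L²/s²`, `V`, `Z` of eq. (64)–(66)
are these with `a = 1/r² + i/s²`. [cite: ChenQuantumLattice2024, §3.6.4 eq. (64)–(66) p. 52–53] -/
theorem lineClass_dots (x y u : Fin n → ℤ) (L k₀ : ℤ) :
    (L • x) ⬝ᵥ (L • x) = L ^ 2 * (x ⬝ᵥ x) ∧ (L • x) ⬝ᵥ (y - k₀ • x) = L * (x ⬝ᵥ y - k₀ * (x ⬝ᵥ x)) ∧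
      (L • x) ⬝ᵥ (-u) = -(L * (x ⬝ᵥ u)) ∧ (y - k₀ • x) ⬝ᵥ (-u) = -(y ⬝ᵥ u) + k₀ * (x ⬝ᵥ u) ∧
      (y - k₀ • x) ⬝ᵥ (y - k₀ • x) = y ⬝ᵥ y - 2 * k₀ * (x ⬝ᵥ y) + k₀ ^ 2 * (x ⬝ᵥ x) := by
  simp only [smul_dotProduct, dotProduct_smul, sub_dotProduct, dotProduct_sub, dotProduct_neg, smul_eq_mul,
    dotProduct_comm y x]
  refine ⟨?_, ?_, ?_, ?_, ?_⟩ <;> first | trivial | ring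

/-- **Lemma 3.27, exactly: `|φ₆⟩` as finitely many balls per period, each weighted by a Poisson-resummed
class sum (the comb).**  Hypotheses as in `phi6_classes` (`P = MN`, `M = 2N`, `x = D·b₀`, `N = L·D`) and ANY
`κ′ ∈ ℤ`.  With `β := bM² + 2i`, `w := c̃ + z′`, `g := w + h̃* − y`, and per class `k₀` the data
`X := L·x`, `Y := y − k₀x`, `Z := −c̃` (`lineClass_dots`: `‖X‖² = L²‖x‖²`, `c₀ := ⟨X,Y⟩/‖X‖² =
(⟨x,y⟩ − k₀‖x‖²)/(L‖x‖²)`, `⟨X,Z⟩/P = −L⟨x,c̃⟩/P = −⟨b₀,c̃⟩/M`):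
`|φ₆⟩(c) = Mⁿ e^{2πiΣ(wᵢ/M)²} β^{−n/2} Σ_{k₀∈ℤ_L} ballSum(k₀) · e(⟨h̃*,c̃⟩/P) e^{−πa(‖Y‖² − ⟨X,Y⟩²/‖X‖²)}
   e^{2πi⟨Y,Z⟩/P} e^{2πiκ′c₀²} (A′)^{−1/2} Σ_{j∈ℤ} e^{−(π/A′)(j + W)²} e^{−2πic₀(j + W)}`,
`A′ := a‖x‖²L² + 2κ′i`, `W := ⟨X,Z⟩/P + 2κ′c₀`.  THE CHOICE OF `κ′` (eq. (67)–(68)): `Im(a‖x‖²L²) =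
‖x‖²L²/s² = U′ − U′s⁴/(s⁴+r⁴)` with `U′ = t²/(2D²)` under C.5 (`classRate_of_C5`), and C.1 makes
`U′ ∈ 2ℤ` (`four_mul_sq_dvd_of_C1`); for `2κ′ = −U′` the rate `A′ = ‖x‖²L²/r² − iU′s⁴/(s⁴+r⁴)` is TINY, so
`j ↦ e^{−(π/A′)(j+W)²}` is a sharp selector: class `k₀` is lit iff `W ∈ ℤ + O(√|A′|)`.  Which classes that
are is `comb_selector_at_centre` (eq. (29) = (75)); the exact profile along the line is `comb_profile_sq`
(eq. (74)).  No `≈` has been taken: this is an identity of absolutely convergent series for all outcomes.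
[cite: ChenQuantumLattice2024, §3.5.6 Lemma 3.27–3.28 eq. (27)–(29) p. 27–29; §3.6.4 eq. (64)–(72) p. 52–55;
Cond. C.1, C.2, C.5 p. 18–19] -/
theorem phi6_comb {P M N L D : ℕ} [NeZero P] [NeZero M] [NeZero N] [NeZero L] (hP : P = M * N)
    (hM : M = 2 * N) (hN : N = L * D) {a b : ℂ} (ha : 0 < a.re) (hb : 0 < b.re) {x : Fin n → ℤ} (hx : x ≠ 0)
    (b₀ : Fin n → ℤ) (hxb : ∀ i, x i = D * b₀ i) (y z' : Fin n → ℤ) (hs : Fin n → ZMod N)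
    (c : Fin n → ZMod M) (κ' : ℤ) :
    phi6 P N a b x y z' hs c
      = (M : ℂ) ^ n * (cexp (2 * π * I * ∑ i, ((((((c i).val : ℤ) + z' i : ℤ)) : ℂ) / M) ^ 2) *
          (1 / (b * (M : ℂ) ^ 2 + 2 * I) ^ (1 / 2 : ℂ)) ^ n) *
        ∑ k₀ : ZMod L, ballSum (b * (M : ℂ) ^ 2 + 2 * I) N M (fun i => ((c i).val : ℤ) + z' i)
            (fun i => ((c i).val : ℤ) + z' i + (hs i).val - y i) x (k₀.val : ℤ) *
          (e ((((∑ i, ((hs i).val : ℤ) * ((c i).val : ℤ) : ℤ)) : ℚ) / P) *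
            (cexp (-π * a * ((((y - (k₀.val : ℤ) • x) ⬝ᵥ (y - (k₀.val : ℤ) • x) : ℤ) : ℂ)
                  - ((((L : ℤ) • x) ⬝ᵥ (y - (k₀.val : ℤ) • x) : ℤ) : ℂ) ^ 2
                    / ((((L : ℤ) • x) ⬝ᵥ ((L : ℤ) • x) : ℤ) : ℂ))) *
              cexp (2 * π * I * (((y - (k₀.val : ℤ) • x) ⬝ᵥ (-fun i => ((c i).val : ℤ)) : ℤ) : ℂ) / P) *
              (cexp (2 * π * I * κ' * (((((L : ℤ) • x) ⬝ᵥ (y - (k₀.val : ℤ) • x) : ℤ) : ℂ)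
                    / ((((L : ℤ) • x) ⬝ᵥ ((L : ℤ) • x) : ℤ) : ℂ)) ^ 2) *
                (1 / (a * ((((L : ℤ) • x) ⬝ᵥ ((L : ℤ) • x) : ℤ) : ℂ) + 2 * κ' * I) ^ (1 / 2 : ℂ))) *
              ∑' j : ℤ, cexp (-π / (a * ((((L : ℤ) • x) ⬝ᵥ ((L : ℤ) • x) : ℤ) : ℂ) + 2 * κ' * I)
                    * (j + (((((L : ℤ) • x) ⬝ᵥ (-fun i => ((c i).val : ℤ)) : ℤ) : ℂ) / P
                        + 2 * κ' * (((((L : ℤ) • x) ⬝ᵥ (y - (k₀.val : ℤ) • x) : ℤ) : ℂ)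
                            / ((((L : ℤ) • x) ⬝ᵥ ((L : ℤ) • x) : ℤ) : ℂ)))) ^ 2) *
                cexp (-2 * π * I * (((((L : ℤ) • x) ⬝ᵥ (y - (k₀.val : ℤ) • x) : ℤ) : ℂ)
                      / ((((L : ℤ) • x) ⬝ᵥ ((L : ℤ) • x) : ℤ) : ℂ))
                    * (j + (((((L : ℤ) • x) ⬝ᵥ (-fun i => ((c i).val : ℤ)) : ℤ) : ℂ) / P
                        + 2 * κ' * (((((L : ℤ) • x) ⬝ᵥ (y - (k₀.val : ℤ) • x) : ℤ) : ℂ)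
                            / ((((L : ℤ) • x) ⬝ᵥ ((L : ℤ) • x) : ℤ) : ℂ))))))) := by
  have hX : ((L : ℤ) • x) ≠ 0 := by
    intro h
    apply hx
    funext i
    have hi := congr_fun h i
    simp only [Pi.smul_apply, smul_eq_mul, Pi.zero_apply, mul_eq_zero, Nat.cast_eq_zero] at hi
    exact hi.resolve_left (NeZero.ne L)
  rw [phi6_classes hP hM hN ha hb hx b₀ hxb y z' hs c]
  congr 1
  refine Finset.sum_congr rfl fun k₀ _ => ?_
  congr 1
  rw [classSum_reindex]
  congr 1
  exact step2_tsum_exact_chirp ha hX _ _ (NeZero.ne P) κ'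

/-! ### Where Cond. C.1 and C.5 enter: the class rate and the integrality of `t²/(4D²)` -/

/-- **The class rate under Cond. C.5.**  `a = 1/r² + i/s²` (`karstRate`), `N = t² + u²` (`u² = ‖x‖²`),
`L·D = N`, and C.5 (`s²r⁴t²/(u²(s⁴+r⁴)(t²+u²)²) = 2`, the hypothesis of `rate_shift_of_C5`) give, for the rate
`a‖x‖²L²` of the class sums and `U′ := t²/(2D²)`:
`a·u²·L² − iU′ = u²L²/r² − i·U′s⁴/(s⁴+r⁴)`
— eq. (65)–(67): `Im(a u²L²) = U′ − ε′`, `ε′ = U′s⁴/(s⁴+r⁴) ∈ t²s⁴/(2r⁴)·(1/D², 1)`; after removing the even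
integer `U′` (C.1, `four_mul_sq_dvd_of_C1`) what is left has tiny real AND imaginary part.
[cite: ChenQuantumLattice2024, eq. (65)–(68) p. 53–54; Cond. C.1, C.5 p. 18–19] -/
theorem classRate_of_C5 {r s t u D L N : ℝ} (hu : u ≠ 0) (hs : s ≠ 0) (hD : D ≠ 0) (hN0 : N ≠ 0)
    (hrs : s ^ 4 + r ^ 4 ≠ 0) (hN : N = t ^ 2 + u ^ 2) (hL : L * D = N)
    (hC5 : s ^ 2 * r ^ 4 / (u ^ 2 * (s ^ 4 + r ^ 4)) * (t ^ 2 / (t ^ 2 + u ^ 2) ^ 2) = 2) :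
    karstRate r s * ((u ^ 2 * L ^ 2 : ℝ) : ℂ) - ((t ^ 2 / (2 * D ^ 2) : ℝ) : ℂ) * I
      = ((u ^ 2 * L ^ 2 / r ^ 2 : ℝ) : ℂ) - ((t ^ 2 / (2 * D ^ 2) * (s ^ 4 / (s ^ 4 + r ^ 4)) : ℝ) : ℂ) * I := by
  rw [← hN] at hC5
  have hC5' : s ^ 2 * r ^ 4 * t ^ 2 = 2 * (u ^ 2 * (s ^ 4 + r ^ 4)) * N ^ 2 := by
    field_simp at hC5
    linear_combination hC5
  have hL2 : L ^ 2 = N ^ 2 / D ^ 2 := by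
    rw [← hL]
    field_simp
  have hre : 1 / r ^ 2 * (u ^ 2 * L ^ 2) = u ^ 2 * L ^ 2 / r ^ 2 := by ring
  have him : 1 / s ^ 2 * (u ^ 2 * L ^ 2) - t ^ 2 / (2 * D ^ 2)
      = -(t ^ 2 / (2 * D ^ 2) * (s ^ 4 / (s ^ 4 + r ^ 4))) := by
    rw [hL2]
    field_simp
    linear_combination (-1 : ℝ) * hC5'
  apply Complex.ext
  · simp only [karstRate, Complex.sub_re, Complex.add_re, Complex.mul_re, Complex.mul_im, Complex.add_im,
      Complex.ofReal_re, Complex.ofReal_im, Complex.I_re, Complex.I_im]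
    linear_combination hre
  · simp only [karstRate, Complex.sub_im, Complex.add_re, Complex.mul_re, Complex.mul_im, Complex.add_im,
      Complex.ofReal_re, Complex.ofReal_im, Complex.I_re, Complex.I_im]
    linear_combination him

/-- **Cond. C.1 makes `U′ = t²/(2D²)` an even integer.**  If `t² = c·u²` with `4 ∣ c` and `u² = D²·‖b₀‖²`
(`x = D·b₀`), then `4D² ∣ t²`; hence `2κ′ := −U′ = −2·(t²/(4D²)) ∈ 2ℤ` and the chirp `e^{2πiκ′ℓ²}` is `1` on
`ℤ` — "Cond. C.1 is only used here, in the proof of Lemma 3.27" (Remark after C.8).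
[cite: ChenQuantumLattice2024, Cond. C.1 p. 18 and the remark p. 19; eq. (67)–(68) p. 53–54] -/
theorem four_mul_sq_dvd_of_C1 {c u2 D bb t2 : ℤ} (hc : 4 ∣ c) (ht : t2 = c * u2) (hu : u2 = D ^ 2 * bb) :
    4 * D ^ 2 ∣ t2 := by
  obtain ⟨c', rfl⟩ := hc
  subst ht
  subst hu
  exact ⟨c' * bb, by ring⟩

/-! ### The dictionary with eq. (29) = (75) and the profile (74), scalar shadows -/

/-- **Which classes are lit: the selector phase at a ball centre (Lemma 3.28, eq. (29) = (75)).**  Scalar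
shadow over `ℝ` (`uu = ‖x‖²`, `N = t² + uu`, `L·D = N`, `P = 2N²` (C.2), `2κ′ = −t²/(2D²)`).  For the class
`(k₀, Ξ)` put `m := k₀ + ⟨x,Ξ⟩ ∈ ℤ` and evaluate the selector phase of `phi6_comb`,
`W = ⟨X,Z⟩/P + 2κ′c₀ = −L⟨x,c̃⟩/P + 2κ′(⟨x,y⟩ − k₀uu)/(L·uu)`, at the ball centre `c̃* = −e − k₀x − NΞ`,
`e := z′ + h̃* − y` (so `⟨x,c̃*⟩ = −⟨x,e⟩ − k₀uu − N⟨x,Ξ⟩`: hypothesis `hc`, with `xe = ⟨x,e⟩`, `xXi = ⟨x,Ξ⟩`,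
`xy = ⟨x,y⟩`).  Result: `W = (m + e₀)/(2D)` with `e₀ := ⟨x, z′+h̃*⟩/N − ⟨x,y⟩/‖x‖² = (xe + xy)/N − xy/uu` —
the quantity `e₀` of eq. (29).  READING (`k′ :=` nearest integer to `e₀`, `e₀′ := e₀ − k′`): the selector
`e^{−(π/A′)(j+W)²}` has unit size only on the classes `m ≡ −k′ (mod 2D)`, whose centres
`−e − k₀x − NΞ = (M/2)k_c − (z′+h̃*−y) − x⟨x,k_c⟩ + (2Dj + k′)·x` (`k_c := −Ξ`, `2Dj := −m − k′`) are exactly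
the support of eq. (29); on the other classes `|2D(W − j)| ≥ 1/2` for every `j` and the class is dark.  At
displacement `ε·x` from a lit centre `2D(W − j) = e₀′ − ε·uu/N` (only `Z = −c̃` moves), which with the ball
factor gives the profile `comb_profile_sq` (maximum at `ε = e₀′`: the shift `x·(e₀ − k′)` of eq. (75)).
Moving to the next class along the line (`m ↦ m + μ`) changes `W` by `μ/(2D)`: the period `2D` of eq. (69).
[cite: ChenQuantumLattice2024, eq. (29) p. 28–29 (definition of `e₀`, `k′`); eq. (69), (73), (75) p. 54–55] -/
theorem comb_selector_at_centre {t uu N D L P xc xe xy xXi k₀ : ℝ} (huu : uu ≠ 0) (hN0 : N ≠ 0)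
    (hD : D ≠ 0) (hN : N = t ^ 2 + uu) (hL : L * D = N) (hP : P = 2 * N ^ 2)
    (hc : xc = -xe - k₀ * uu - N * xXi) :
    -(L * xc) / P + 2 * (-(t ^ 2 / (4 * D ^ 2))) * ((xy - k₀ * uu) / (L * uu))
      = (k₀ + xXi + ((xe + xy) / N - xy / uu)) / (2 * D) := by
  have hL' : L = N / D := by
    rw [← hL]
    field_simp
  rw [hc, hP, hL']
  field_simp
  rw [hN]
  ring

/-- **The profile along the line (eq. (74)–(75)), scalar shadow.**  Under C.5 (`β = σ²/N²`) the ball factor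
of a lit class at displacement `ε·x` from its centre has modulus `e^{−π·uu·ε²/σ²}`, and the selector factor
has modulus `e^{−π Re(1/A′)(j+W)²}` with `2D(W − j) = e₀′ − ε·uu/N` (`comb_selector_at_centre`) and
`Re(1/A′)/(2DN)² ≈ 1/(σ²t²)` (C.5–C.7: `4D²N²·Re A′ = 4uuN⁴/r² ≈ σ²t²`, `|Im A′| ≪ Re A′`), i.e.
`≈ e^{−π(e₀′N − ε·uu)²/(σ²t²)}`.  The exact identity behind the two exponents is: for `N = t² + uu`,
`t²·uu·ε² + (e₀N − ε·uu)² = uu·N·(ε − e₀)² + e₀²·N·t²`;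
so the product is a Gaussian in `ε` CENTRED AT `e₀′` (the shift `x·(e₀ − k′)` of eq. (75)) with
`e^{−π·uu·N·(ε−e₀′)²/(σ²t²)}`, i.e. parallel width² `σ²t²/N = σ²·c/(c+1)` in length (eq. (74):
`W_ℓ(2D‖x‖)² ∈ (0.5, 1)·σ²`), times the outcome weight `e^{−π e₀′² N/σ²}`.
[cite: ChenQuantumLattice2024, eq. (73)–(75) p. 55; Lemma 3.28 p. 55; Cond. C.5–C.7 p. 18–19] -/
theorem comb_profile_sq (t uu N e₀ ε : ℝ) (hN : N = t ^ 2 + uu) :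
    t ^ 2 * (uu * ε ^ 2) + (e₀ * N - ε * uu) ^ 2 = uu * N * (ε - e₀) ^ 2 + e₀ ^ 2 * N * t ^ 2 := by
  subst hN
  ring

end Lemma327

end

end Literature.Computability.Cryptography.Chen2024
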